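import Summits.HubbardSuperconductivity.HubbardSuperconductivity.Theorems.SoloBlindFiniteVolumeCriterion
import Summits.HubbardSuperconductivity.HubbardSuperconductivity.Theorems.SoloBlindPairFieldLocality
import Summits.HubbardSuperconductivity.HubbardSuperconductivity.Theorems.SoloBlindParticleHoleSectors
import Literature.MathematicalPhysics.QuantumLattice.HubbardModelProofs
import Literature.MathematicalPhysics.QuantumLattice.FermionOperatorsProofs
import HarnessLib

/-!
# Particle–hole symmetry of the target: hole doping `δ` ≡ electron doping `δ`

Obstruction report, Theorem 20 (session 13). The summit fixes HOLE doping, `N_L = 2⌊(1-δ)L²/2⌋`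
electrons on the even `L × L` torus. The model being the PURE Hubbard model (`t' = 0`) on a
bipartite graph, Lieb's particle–hole map `P : c_{xσ} ↦ ε_x c†_{xσ}`, `ε_x = (-1)^{x₁+x₂}`
(`particleHole`, `torusStagger`) is a unitary with `P H Pᴴ = H - UN + UL²`, `P N Pᴴ = 2L² - N`,
`P S^z Pᴴ = -S^z`; so `Pᴴ` maps the unit ground states of the joint sector `(N, S^z = M)` onto
those of `(2L² - N, -M)` (`isGroundStateInSector_conjTranspose_mulVec`, any bipartite graph). On a
singlet pair field with real form factor vanishing at `0` it acts as `P Δ_g Pᴴ = Δ_gᴴ` (the two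
sites of a bond carry opposite signs; `particleHole_mul_pairField_mul_conjTranspose`), whence
`⟨Δ_g†Δ_g⟩_{Pᴴψ} = ⟨Δ_gΔ_g†⟩_ψ = ⟨Δ_g†Δ_g⟩_ψ + ⟨[Δ_g, Δ_g†]⟩_ψ` with `‖[Δ_g, Δ_g†]‖ ≤ 800L²`
(Theorem 11). Consequently (`hubbardSuperconductivity_iff_electronDoped`) **the summit is
EQUIVALENT to its electron-doped twin**: `d_{x²-y²}` order `≥ cL⁴` on every unit ground state of
the sector with `2L² - 2⌊(1-δ)L²/2⌋` electrons (density `1 + δ`). Reading (report §2, §6): at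
`t' = 0` there is no hole/electron asymmetry — evidence or a refutation may be sought on either
side of half filling; the cuprates' asymmetry is a `t' ≠ 0` effect outside this statement.
Lieb, PRL 62 (1989) 1201; Lieb–Wu, Physica A 321 (2003) 1, §1 (3). [this work]
-/

noncomputable section

namespace Summit.HubbardSuperconductivity.HubbardSuperconductivity.Theorems

open Matrix Finset Literature.Probability.LatticeModels Literature.MathematicalPhysics.QuantumLattice
  HubbardWave0
open scoped ComplexOrder ComplexConjugate Matrix.Norms.L2Operator

namespace ParticleHole

-- see `SoloBlindPairFieldLocality`: make instance synthesis agree with the landed terms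
-- (`DecidableEq` on `Lex` types through the linear order, not Mathlib's `instDecidableEqLex`),
-- file-locally; no instance is added.
attribute [-instance] instDecidableEqLex

/-! ### The pair field on the even torus: `P Δ_g Pᴴ = Δ_gᴴ` -/

section Torus

variable {L : ℕ} [NeZero L]

/-- One unit step flips Yang's sign on the torus of even side. Lieb, PRL 62 (1989) 1201. [folklore] -/
theorem torusStagger_ofTorusSite_add_unitStep (hL : Even L) (x : TorusSite 2 L) {e : Site 2}
    (he : e ∈ unitSteps) :
    torusStagger (FermionTorus.ofTorusSite (x + Torus.proj L e)) =
      -torusStagger (FermionTorus.ofTorusSite (L := L) x) := by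
  have hproj : ∀ i : Fin 2, Torus.proj (d := 2) L (Pi.single i 1) = Pi.single i 1 := by
    intro i; funext j
    by_cases h : j = i
    · subst h; simp [Torus.proj_apply]
    · simp [Torus.proj_apply, h]
  have hneg : ∀ i : Fin 2, Torus.proj (d := 2) L (-Pi.single i 1) = -Pi.single i 1 := by
    intro i; funext j
    by_cases h : j = i
    · subst h; simp [Torus.proj_apply]
    · simp [Torus.proj_apply, h]
  have hplus : ∀ i : Fin 2, torusStagger (FermionTorus.ofTorusSite (x + Torus.proj L (Pi.single i 1))) =
      -torusStagger (FermionTorus.ofTorusSite (L := L) x) := fun i =>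
    torusStagger_eq_neg_of_toTorusSite_eq hL (i := i)
      (by rw [FermionTorus.toTorusSite_ofTorusSite, FermionTorus.toTorusSite_ofTorusSite, hproj])
  have hminus : ∀ i : Fin 2, torusStagger (FermionTorus.ofTorusSite (x + Torus.proj L (-Pi.single i 1))) =
      -torusStagger (FermionTorus.ofTorusSite (L := L) x) := by
    intro i
    have h := torusStagger_eq_neg_of_toTorusSite_eq hL (i := i)
      (x := FermionTorus.ofTorusSite (x + Torus.proj L (-Pi.single i 1)))
      (y := FermionTorus.ofTorusSite x)
      (by rw [FermionTorus.toTorusSite_ofTorusSite, FermionTorus.toTorusSite_ofTorusSite, hneg,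
        neg_add_cancel_right])
    rw [h, neg_neg]
  simp only [unitSteps, Finset.mem_insert, Finset.mem_singleton] at he
  rcases he with rfl | rfl | rfl | rfl
  · exact hplus 0
  · exact hminus 0
  · exact hplus 1
  · exact hminus 1

/-- **`P Δ_g Pᴴ = Δ_gᴴ` locally**: for a real form factor with `g 0 = 0` the local singlet pair
`P_x = Σ_e (g e/√2)(c_{x↑}c_{x+e,↓} - c_{x↓}c_{x+e,↑})` is sent to its adjoint
(`P c_a c_b Pᴴ = ε_a ε_b c†_a c†_b`, `ε_x ε_{x+e} = -1`, CAR). [this work] -/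
theorem particleHole_mul_localPair_mul_conjTranspose (hL : Even L) (g : Site 2 → ℝ) (hg0 : g 0 = 0)
    (x : TorusSite 2 L) :
    particleHole (fun j : Orb (FermionTorus 2 L) => ((torusStagger (ofLex j).1 : ℤ) : ℂ)) *
        localPair g L x *
        (particleHole (fun j : Orb (FermionTorus 2 L) => ((torusStagger (ofLex j).1 : ℤ) : ℂ)))ᴴ =
      (localPair g L x)ᴴ := by
  set ε' : Orb (FermionTorus 2 L) → ℂ := fun j => ((torusStagger (ofLex j).1 : ℤ) : ℂ) with hε'
  have hn : ∀ i, ‖ε' i‖ = 1 := fun i => norm_intCast_units _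
  set P := particleHole ε' with hP
  have hPP : Pᴴ * P = 1 := particleHole_conjTranspose_mul ε' hn
  have hc : ∀ a, P * annihilation a * Pᴴ = ε' a • creation a :=
    particleHole_mul_annihilation_mul_conjTranspose_holds ε' hn
  have hprod : ∀ a b, P * (annihilation a * annihilation b) * Pᴴ =
      (ε' a * ε' b) • (creation a * creation b) := by
    intro a b
    have h : P * annihilation a * Pᴴ * (P * annihilation b * Pᴴ) =
        P * (annihilation a * annihilation b) * Pᴴ := by
      simp only [Matrix.mul_assoc]
      rw [← Matrix.mul_assoc Pᴴ P, hPP, Matrix.one_mul]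
    rw [← h, hc, hc, Matrix.smul_mul, Matrix.mul_smul, smul_smul]
  have hcar : ∀ a b : Orb (FermionTorus 2 L), creation b * creation a = -(creation a * creation b) :=
    fun a b => eq_neg_of_add_eq_zero_right (creation_anticomm a b)
  unfold localPair
  rw [Finset.mul_sum, Finset.sum_mul, conjTranspose_sum]
  refine Finset.sum_congr rfl fun e he => ?_
  rw [Finset.mem_insert] at he
  rcases he with rfl | he
  · simp [hg0]
  set X := FermionTorus.ofTorusSite (L := L) x with hX
  set Y := FermionTorus.ofTorusSite (L := L) (x + Torus.proj L e) with hY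
  have hsign : ∀ σ τ : Fin 2, ε' (orb X σ) * ε' (orb Y τ) = -1 := by
    intro σ τ
    have hflip : torusStagger Y = -torusStagger X := torusStagger_ofTorusSite_add_unitStep hL x he
    simp only [hε', orb, ofLex_toLex]
    rw [mul_comm]
    exact intCast_units_mul_of_eq_neg hflip
  rw [Matrix.mul_smul, Matrix.smul_mul, conjTranspose_smul, Matrix.mul_sub, Matrix.sub_mul, hprod,
    hprod, hsign, hsign, conjTranspose_sub, conjTranspose_mul, conjTranspose_mul,
    annihilation_conjTranspose, annihilation_conjTranspose, annihilation_conjTranspose,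
    annihilation_conjTranspose, hcar (orb X 0) (orb Y 1), hcar (orb X 1) (orb Y 0), neg_one_smul,
    neg_one_smul]
  congr 1
  exact (Complex.conj_ofReal _).symm

/-- **`P Δ_g Pᴴ = Δ_gᴴ`** on the even torus for a real form factor with `g 0 = 0` (in particular
for `dWaveFormFactor`). [this work] -/
theorem particleHole_mul_pairField_mul_conjTranspose (hL : Even L) (g : Site 2 → ℝ) (hg0 : g 0 = 0) :
    particleHole (fun j : Orb (FermionTorus 2 L) => ((torusStagger (ofLex j).1 : ℤ) : ℂ)) *
        pairField g L *
        (particleHole (fun j : Orb (FermionTorus 2 L) => ((torusStagger (ofLex j).1 : ℤ) : ℂ)))ᴴ =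
      (pairField g L)ᴴ := by
  unfold pairField
  rw [Finset.mul_sum, Finset.sum_mul, conjTranspose_sum]
  exact Finset.sum_congr rfl fun x _ => particleHole_mul_localPair_mul_conjTranspose hL g hg0 x

/-- **The order functional on conjugates**: `re⟨Pᴴψ, Δ_gᴴΔ_g Pᴴψ⟩ = re⟨ψ, Δ_gΔ_gᴴ ψ⟩` differs from
`re⟨ψ, Δ_gᴴΔ_g ψ⟩` by at most `‖[Δ_g, Δ_gᴴ]‖ ≤ 800 L²` for unit `ψ`, `|g| ≤ 1`, `g 0 = 0`
(Theorem 11's commutator bound). [this work] -/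
theorem abs_re_expect_conjTranspose_mulVec_sub_le (hL : Even L) (g : Site 2 → ℝ) (hg0 : g 0 = 0)
    (hg : ∀ e, |g e| ≤ 1) {ψ : Fock (Orb (FermionTorus 2 L))} (h1 : star ψ ⬝ᵥ ψ = 1) :
    |(expect ((pairField g L)ᴴ * pairField g L)
          ((particleHole (fun j : Orb (FermionTorus 2 L) => ((torusStagger (ofLex j).1 : ℤ) : ℂ)))ᴴ *ᵥ
            ψ)).re -
        (expect ((pairField g L)ᴴ * pairField g L) ψ).re| ≤ 800 * (L : ℝ) ^ 2 := by
  set ε' : Orb (FermionTorus 2 L) → ℂ := fun j => ((torusStagger (ofLex j).1 : ℤ) : ℂ) with hε'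
  have hn : ∀ i, ‖ε' i‖ = 1 := fun i => norm_intCast_units _
  set P := particleHole ε' with hP
  set D := pairField g L with hD
  have hPD : P * D * Pᴴ = Dᴴ := particleHole_mul_pairField_mul_conjTranspose hL g hg0
  have hPP : Pᴴ * P = 1 := particleHole_conjTranspose_mul ε' hn
  -- `P Dᴴ Pᴴ = D`, hence `Dᴴ D Pᴴ = Pᴴ (D Dᴴ)`
  have hPDh : P * Dᴴ * Pᴴ = D := by
    have h := congrArg conjTranspose hPD
    rwa [conjTranspose_mul, conjTranspose_mul, conjTranspose_conjTranspose,
      conjTranspose_conjTranspose, ← Matrix.mul_assoc] at h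
  have hkey : Dᴴ * D * Pᴴ = Pᴴ * (D * Dᴴ) := by
    calc Dᴴ * D * Pᴴ = Pᴴ * (P * Dᴴ * Pᴴ) * (P * D * Pᴴ) := by
          simp only [Matrix.mul_assoc]
          rw [← Matrix.mul_assoc Pᴴ P, hPP, Matrix.one_mul, ← Matrix.mul_assoc Pᴴ P, hPP,
            Matrix.one_mul]
      _ = Pᴴ * (D * Dᴴ) := by rw [hPDh, hPD, Matrix.mul_assoc]
  have hexp : expect (Dᴴ * D) (Pᴴ *ᵥ ψ) = expect (D * Dᴴ) ψ := by
    have hv : (Dᴴ * D) *ᵥ (Pᴴ *ᵥ ψ) = Pᴴ *ᵥ ((D * Dᴴ) *ᵥ ψ) := by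
      rw [mulVec_mulVec, mulVec_mulVec, hkey]
    unfold Literature.MathematicalPhysics.QuantumLattice.expect
    rw [hv, star_conjTranspose_mulVec_dotProduct ε' hn]
  -- `D Dᴴ = Dᴴ D + [D, Dᴴ]` and `|re⟨ψ, [D,Dᴴ] ψ⟩| ≤ ‖[D, Dᴴ]‖ ≤ 800 L²`
  have hsplit : expect (D * Dᴴ) ψ = expect (Dᴴ * D) ψ + expect (D * Dᴴ - Dᴴ * D) ψ := by
    unfold Literature.MathematicalPhysics.QuantumLattice.expect
    rw [sub_mulVec, dotProduct_sub, add_sub_cancel]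
  have hbound : |(expect (D * Dᴴ - Dᴴ * D) ψ).re| ≤ 800 * (L : ℝ) ^ 2 := by
    have h := PairTower.abs_re_expect_le_norm_mul (D * Dᴴ - Dᴴ * D) ψ
    rw [ThermodynamicLimit.norm_toLp_sq, h1, Complex.one_re, mul_one] at h
    exact h.trans (PairTower.norm_commutator_pairField_conjTranspose_le (L := L) g hg)
  rw [hexp, hsplit, Complex.add_re, add_sub_cancel_left]
  exact hbound

/-! ### Transfer of the uniform order bound between the sectors `N` and `2L² - N` -/

/-- **Particle–hole transfer of a uniform order bound.** On the even torus, if every unit ground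
state of `H(1,U)` in the joint sector `(N, S^z = 0)` (`N ≤ 2L²`) has `re⟨Δ_g†Δ_g⟩ ≥ c`, then every
unit ground state in the sector `(2L² - N, S^z = 0)` has `re⟨Δ_g†Δ_g⟩ ≥ c - 800 L²`
(`g` real, `|g| ≤ 1`, `g 0 = 0`). [this work] -/
theorem uniform_bound_particleHole (hL : Even L) (U : ℝ) (g : Site 2 → ℝ) (hg0 : g 0 = 0)
    (hg : ∀ e, |g e| ≤ 1) {N : ℕ} (hN : N ≤ 2 * L ^ 2) {c : ℝ}
    (hc : ∀ ψ : Fock (Orb (FermionTorus 2 L)), star ψ ⬝ᵥ ψ = 1 →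
      IsGroundStateInSector (hubbardTorus 2 L 1 U) N 0 ψ →
        c ≤ (expect ((pairField g L)ᴴ * pairField g L) ψ).re)
    (φ : Fock (Orb (FermionTorus 2 L))) (h1 : star φ ⬝ᵥ φ = 1)
    (hφ : IsGroundStateInSector (hubbardTorus 2 L 1 U) (2 * L ^ 2 - N) 0 φ) :
    c - 800 * (L : ℝ) ^ 2 ≤ (expect ((pairField g L)ᴴ * pairField g L) φ).re := by
  have hn : ∀ j : Orb (FermionTorus 2 L), ‖((torusStagger (ofLex j).1 : ℤ) : ℂ)‖ = 1 :=
    fun j => norm_intCast_units _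
  have hcard : Fintype.card (FermionTorus 2 L) = L ^ 2 := by
    simp [FermionTorus, Fintype.card_lex]
  -- `Pᴴφ` is a unit ground state of the sector `(N, 0)`
  have hgs : IsGroundStateInSector (hubbardTorus 2 L 1 U) N 0
      ((particleHole (fun j : Orb (FermionTorus 2 L) => ((torusStagger (ofLex j).1 : ℤ) : ℂ)))ᴴ *ᵥ
        φ) := by
    have h := isGroundStateInSector_conjTranspose_mulVec (fermionTorusGraph 2 L) torusStagger
      (fun x y h => torusStagger_eq_neg_of_adj_holds hL h) 1 U (N := 2 * L ^ 2 - N) (M := 0)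
      (by rw [hcard]; omega) hφ h1
    rwa [hcard, show 2 * L ^ 2 - (2 * L ^ 2 - N) = N by omega, neg_zero] at h
  have hψ1 : star ((particleHole (fun j : Orb (FermionTorus 2 L) =>
        ((torusStagger (ofLex j).1 : ℤ) : ℂ)))ᴴ *ᵥ φ) ⬝ᵥ
      ((particleHole (fun j : Orb (FermionTorus 2 L) => ((torusStagger (ofLex j).1 : ℤ) : ℂ)))ᴴ *ᵥ
        φ) = 1 := by
    rw [star_conjTranspose_mulVec_dotProduct _ hn, h1]
  have hcψ := hc _ hψ1 hgs
  have habs := abs_re_expect_conjTranspose_mulVec_sub_le hL g hg0 hg h1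
  rw [abs_le] at habs
  linarith [habs.2]

end Torus

/-! ### The summit and its electron-doped twin -/

/-- **Theorem 20. Particle–hole symmetry of the target.** `HubbardSuperconductivity` (uniform
`d_{x²-y²}` pair-field order `≥ cL⁴` on all unit ground states of the HOLE-doped sector
`N = 2⌊(1-δ)L²/2⌋`, `S^z = 0`, of `H(1,U)` on the even `L × L` torus, some `U > 0`, `δ ∈ (0,1/2)`,
all large even `L` — Theorem 1) is EQUIVALENT to the same assertion for the ELECTRON-doped
sector `N = 2L² - 2⌊(1-δ)L²/2⌋` (density `1 + δ`). Lieb, PRL 62 (1989) 1201 (the map);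
the statement and its use are this report's. [this work] -/
theorem hubbardSuperconductivity_iff_electronDoped :
    HubbardSuperconductivity ↔
      ∃ U : ℝ, 0 < U ∧ ∃ δ ∈ Set.Ioo (0 : ℝ) (1 / 2), ∃ c : ℝ, 0 < c ∧ ∃ L₀ : ℕ,
        ∀ n : ℕ, Even (n + 1) → L₀ ≤ n + 1 →
          ∀ φ : Fock (Orb (FermionTorus 2 (n + 1))), star φ ⬝ᵥ φ = 1 →
            IsGroundStateInSector (hubbardTorus 2 (n + 1) 1 U)
                (2 * (n + 1) ^ 2 - 2 * ⌊(1 - δ) * ((n + 1 : ℕ) : ℝ) ^ 2 / 2⌋₊) 0 φ →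
              c * ((n + 1 : ℕ) : ℝ) ^ 4 ≤
                (expect ((pairField dWaveFormFactor (n + 1))ᴴ * pairField dWaveFormFactor (n + 1))
                  φ).re := by
  have hd1 : ∀ e, |dWaveFormFactor e| ≤ 1 := fun e => by
    unfold dWaveFormFactor; split_ifs <;> simp
  -- the floor never exceeds the number of orbitals
  have hfloor : ∀ (δ : ℝ), δ ∈ Set.Ioo (0 : ℝ) (1 / 2) → ∀ n : ℕ,
      2 * ⌊(1 - δ) * ((n + 1 : ℕ) : ℝ) ^ 2 / 2⌋₊ ≤ 2 * (n + 1) ^ 2 := by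
    intro δ hδ n
    have hle : (1 - δ) * ((n + 1 : ℕ) : ℝ) ^ 2 / 2 ≤ (((n + 1) ^ 2 : ℕ) : ℝ) := by
      have h0 : (0 : ℝ) ≤ ((n + 1 : ℕ) : ℝ) ^ 2 := by positivity
      push_cast at h0 ⊢
      nlinarith [hδ.1, hδ.2]
    have h2 := Nat.floor_mono hle
    rw [Nat.floor_natCast] at h2
    omega
  -- one transfer step, in either direction, at the cost `c ↦ c/2` for `L² ≥ 1600/c`
  have step : ∀ (U : ℝ) (δ : ℝ), δ ∈ Set.Ioo (0 : ℝ) (1 / 2) → ∀ (c : ℝ), 0 < c → ∀ (L₀ : ℕ)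
      (Nh Ne : ℕ → ℕ), (∀ n, Nh n ≤ 2 * (n + 1) ^ 2) → (∀ n, Ne n = 2 * (n + 1) ^ 2 - Nh n) →
      (∀ n : ℕ, Even (n + 1) → L₀ ≤ n + 1 →
        ∀ φ : Fock (Orb (FermionTorus 2 (n + 1))), star φ ⬝ᵥ φ = 1 →
          IsGroundStateInSector (hubbardTorus 2 (n + 1) 1 U) (Nh n) 0 φ →
            c * ((n + 1 : ℕ) : ℝ) ^ 4 ≤
              (expect ((pairField dWaveFormFactor (n + 1))ᴴ * pairField dWaveFormFactor (n + 1))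
                φ).re) →
      ∃ L₁ : ℕ, ∀ n : ℕ, Even (n + 1) → L₁ ≤ n + 1 →
        ∀ φ : Fock (Orb (FermionTorus 2 (n + 1))), star φ ⬝ᵥ φ = 1 →
          IsGroundStateInSector (hubbardTorus 2 (n + 1) 1 U) (Ne n) 0 φ →
            c / 2 * ((n + 1 : ℕ) : ℝ) ^ 4 ≤
              (expect ((pairField dWaveFormFactor (n + 1))ᴴ * pairField dWaveFormFactor (n + 1))
                φ).re := by
    intro U δ hδ c hc L₀ Nh Ne hNh hNe hyp
    refine ⟨max L₀ (⌈Real.sqrt (1600 / c)⌉₊), fun n hn hL φ h1 hφ => ?_⟩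
    have hL₀ : L₀ ≤ n + 1 := le_of_max_le_left hL
    have hL₁ : ⌈Real.sqrt (1600 / c)⌉₊ ≤ n + 1 := le_of_max_le_right hL
    rw [hNe] at hφ
    have h := uniform_bound_particleHole (L := n + 1) hn U dWaveFormFactor dWaveFormFactor_zero hd1
      (hNh n) (fun ψ hψ1 hψ => hyp n hn hL₀ ψ hψ1 hψ) φ h1 hφ
    -- `800 L² ≤ (c/2) L⁴` because `L ≥ √(1600/c)`
    have hsq : 1600 / c ≤ ((n + 1 : ℕ) : ℝ) ^ 2 := by
      have h1' : Real.sqrt (1600 / c) ≤ ((n + 1 : ℕ) : ℝ) :=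
        (Nat.le_ceil _).trans (by exact_mod_cast hL₁)
      have h0 : 0 ≤ Real.sqrt (1600 / c) := Real.sqrt_nonneg _
      nlinarith [Real.sq_sqrt (show (0 : ℝ) ≤ 1600 / c by positivity)]
    have hL2 : 800 * ((n + 1 : ℕ) : ℝ) ^ 2 ≤ c / 2 * ((n + 1 : ℕ) : ℝ) ^ 4 := by
      have hcL : 1600 ≤ ((n + 1 : ℕ) : ℝ) ^ 2 * c := (div_le_iff₀ hc).1 hsq
      have h0 : (0 : ℝ) ≤ ((n + 1 : ℕ) : ℝ) ^ 2 := by positivity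
      nlinarith [mul_nonneg h0 (sub_nonneg.2 hcL)]
    linarith
  rw [hubbardSuperconductivity_iff_uniform_dWave_bound]
  constructor
  · rintro ⟨U, hU, δ, hδ, c, hc, L₀, h⟩
    obtain ⟨L₁, h₁⟩ := step U δ hδ c hc L₀ (fun n => 2 * ⌊(1 - δ) * ((n + 1 : ℕ) : ℝ) ^ 2 / 2⌋₊)
      (fun n => 2 * (n + 1) ^ 2 - 2 * ⌊(1 - δ) * ((n + 1 : ℕ) : ℝ) ^ 2 / 2⌋₊) (hfloor δ hδ)
      (fun n => rfl) h
    exact ⟨U, hU, δ, hδ, c / 2, by positivity, L₁, h₁⟩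
  · rintro ⟨U, hU, δ, hδ, c, hc, L₀, h⟩
    obtain ⟨L₁, h₁⟩ := step U δ hδ c hc L₀
      (fun n => 2 * (n + 1) ^ 2 - 2 * ⌊(1 - δ) * ((n + 1 : ℕ) : ℝ) ^ 2 / 2⌋₊)
      (fun n => 2 * ⌊(1 - δ) * ((n + 1 : ℕ) : ℝ) ^ 2 / 2⌋₊) (fun n => Nat.sub_le _ _)
      (fun n => by have := hfloor δ hδ n; omega) h
    exact ⟨U, hU, δ, hδ, c / 2, by positivity, L₁, h₁⟩

end ParticleHole

end Summit.HubbardSuperconductivity.HubbardSuperconductivity.Theorems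

end
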